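import Mathlib.Order.Interval.Finset.Nat
import Literature.Analysis.Matrix.ExpAbsKernel
import Literature.Probability.LatticeModels.TorusBlockExponentialKernel
import HarnessLib

/-!
# The cyclic distance on an even cycle is of negative type; the cyclic-exponential kernel is
# infinitely divisible as a SITE kernel

Companion (and foil) to `TorusBlockExponentialKernel.lean`: there the `b`-BLOCK kernels of
`K(x, y) = λ^{d_M(x₀-y₀) + d_M(x₁-y₁)}` (`d_M(u) = min(u.val, M - u.val)`, `0 < λ < 1`) were shown NOT
to be of negative log-type for any block size `b ≥ 2`. Here the SITE kernel itself is shown to be of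
negative log-type (infinitely divisible), for `M` even:

* `sum_abs_arc_sub_arc` — the even cycle `ℤ/M`, `M = 2n`, is HYPERCUBE-EMBEDDABLE: with the
  half-arc indicators `a_u(s) = [(u - s).val < n]` one has `Σ_u |a_u(s) - a_u(t)| = 2 d_M(s - t)`
  (two half-arcs offset by `d` differ in `2d` points);
* `isPosDefKernel_exp_neg_mul_cyclicDist` — hence `(s, t) ↦ e^{-c d_M(s-t)}` is positive definite
  for every `c ≥ 0` (a finite Schur product over `u` of pull-backs of the Ornstein–Uhlenbeck kernel
  `e^{-c|x-y|/2}`, `isPosDefKernel_exp_neg_mul_abs_sub`), and `isNegDefKernel_cyclicDist` — `d_M`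
  is a negative definite kernel (Schoenberg);
* `isPosDefKernel_exp_neg_mul_sum_cyclicDist`, `isNegDefKernel_negLog_cyclicExpKernel` — on
  `(ℤ/M)^d` the kernel `λ^{Σᵢ d_M(xᵢ-yᵢ)}`, `0 < λ ≤ 1`, has `-log` of negative type, i.e. ALL its
  Hadamard powers are positive definite.

Reading (calibration of block-infinite-divisibility conjectures, crux `Block2InfDivXXZ` of
`HubbardSuperconductivity/LevyLogBootstrap`): for the massive kernel, BLOCKING DESTROYS infinite
divisibility at every block size, while the crux asserts that 2×2-blocking CREATES it for the
half-filled XXZ ground-state kernel — site-ID and block-ID are logically independent.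
Sources: M. Deza, M. Laurent, *Geometry of Cuts and Metrics* (1997), §§ 6.1, 19.1 (even cycles are
hypercube embeddable; ℓ₁-metrics are of negative type); Berg–Christensen–Ressel (1984) Ch. 3 §2.
Elementary; sorry-free; no definition is introduced.
-/

noncomputable section

open Finset
open scoped BigOperators

namespace Literature.Analysis.Matrix

/-- **Finite Schur products of positive definite kernels are positive definite** (BCR Ch. 3
Thm 1.12 iterated; the empty product is the constant kernel `1`).
[cite: BergChristensenRessel1984, Ch. 3 Thm. 1.12 (PDF p. 71)] -/
theorem isPosDefKernel_finsetProd {X ι : Type*} (s : Finset ι) {φ : ι → X → X → ℝ}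
    (h : ∀ i ∈ s, IsPosDefKernel (φ i)) : IsPosDefKernel fun x y => ∏ i ∈ s, φ i x y := by
  classical
  induction s using Finset.induction_on with
  | empty => simpa using isPosDefKernel_const X zero_le_one
  | insert a s ha ih =>
    have hprod : IsPosDefKernel fun x y => φ a x y * ∏ i ∈ s, φ i x y :=
      (h a (Finset.mem_insert_self a s)).mul (ih fun i hi => h i (Finset.mem_insert_of_mem hi))
    simpa only [Finset.prod_insert ha] using hprod

end Literature.Analysis.Matrix

namespace Literature.Probability.LatticeModels

open Literature.Analysis.Matrix

variable {M n : ℕ} [NeZero M]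

/-! ### Counting: half-arcs on the even cycle -/

/-- **Overlap of two half-arcs.** On `ℤ/M`, `M = 2n`, for a shift `w`:
`#{r < n : (r + w).val < n} = n - d_M(w)`, `d_M(w) = min(w.val, M - w.val)`. [folklore] -/
theorem sum_fin_arcShift_indicator (hM : M = n + n) (w : ZMod M) :
    ∑ r : Fin n, (if ((((r : ℕ) : ℕ) : ZMod M) + w).val < n then (1 : ℝ) else 0) =
      ((n - min w.val (M - w.val) : ℕ) : ℝ) := by
  classical
  have hw : w.val < M := ZMod.val_lt w
  -- pass to `range n` and to a cardinality
  have hval : ∀ r : ℕ, r < n → ((((r : ℕ) : ZMod M) + w).val < n ↔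
      (w.val ≤ n ∧ r < n - w.val) ∨ (n < w.val ∧ M - w.val ≤ r)) := by
    intro r hr
    rw [ZMod.val_add, ZMod.val_cast_of_lt (by omega)]
    rcases lt_or_ge (r + w.val) M with h | h
    · rw [Nat.mod_eq_of_lt h]; omega
    · rw [Nat.mod_eq_sub_mod h, Nat.mod_eq_of_lt (by omega)]; omega
  rw [Fin.sum_univ_eq_sum_range (fun r => if (((r : ℕ) : ZMod M) + w).val < n then (1 : ℝ) else 0),
    Finset.sum_boole]
  have hfilt : (Finset.range n).filter (fun r => (((r : ℕ) : ZMod M) + w).val < n) =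
      (Finset.range n).filter (fun r => (w.val ≤ n ∧ r < n - w.val) ∨ (n < w.val ∧ M - w.val ≤ r)) :=
    Finset.filter_congr fun r hr => hval r (Finset.mem_range.1 hr)
  rw [hfilt]
  rcases le_or_gt w.val n with hle | hgt
  · have hset : (Finset.range n).filter
        (fun r => (w.val ≤ n ∧ r < n - w.val) ∨ (n < w.val ∧ M - w.val ≤ r)) =
        Finset.range (n - w.val) := by
      ext r
      simp only [Finset.mem_filter, Finset.mem_range]
      omega
    have hmin : min w.val (M - w.val) = w.val := by rw [Nat.min_def, if_pos (by omega)]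
    rw [hset, Finset.card_range, hmin]
  · have hset : (Finset.range n).filter
        (fun r => (w.val ≤ n ∧ r < n - w.val) ∨ (n < w.val ∧ M - w.val ≤ r)) =
        Finset.Ico (M - w.val) n := by
      ext r
      simp only [Finset.mem_filter, Finset.mem_range, Finset.mem_Ico]
      omega
    have hmin : min w.val (M - w.val) = M - w.val := by rw [Nat.min_def, if_neg (by omega)]
    rw [hset, Nat.card_Ico, hmin]

/-- **Half-arcs have `n` points**, in shifted form: `Σ_{v ∈ ℤ/M} [(v + w).val < n] = n` (`M = 2n`).
[folklore] -/
theorem sum_arcShift_indicator (hM : M = n + n) (w : ZMod M) :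
    ∑ v : ZMod M, (if (v + w).val < n then (1 : ℝ) else 0) = n := by
  classical
  rw [← Equiv.sum_comp (Equiv.addRight (-w))]
  simp only [Equiv.coe_addRight, neg_add_cancel_right]
  rw [TorusBlock.sum_zmod_eq_sum_half_add hM (fun v => if v.val < n then (1 : ℝ) else 0)]
  have h1 : ∀ s : Fin n, (((s : ℕ) : ℕ) : ZMod M).val < n := fun s => by
    rw [ZMod.val_cast_of_lt (by have := s.isLt; omega)]; exact s.isLt
  have h2 : ∀ s : Fin n, ¬ ((((n + (s : ℕ) : ℕ)) : ZMod M).val < n) := fun s => by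
    rw [ZMod.val_cast_of_lt (by have := s.isLt; omega)]; omega
  simp only [h1, if_true, h2, if_false, Finset.sum_const, Finset.card_univ, Fintype.card_fin,
    nsmul_eq_mul, mul_one, mul_zero, add_zero]

/-- **The even cycle is hypercube embeddable**: for `M = 2n` and `s, t ∈ ℤ/M`, with the half-arc
indicators `a_u(s) = [(u - s).val < n]`,
`Σ_{u ∈ ℤ/M} |a_u(s) - a_u(t)| = 2 · d_M(s - t)`, `d_M(w) = min(w.val, M - w.val)` — the map
`s ↦ (a_u(s))_u ∈ {0,1}^{ℤ/M}` is an isometry onto its image up to the factor `2`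
(Deza–Laurent 1997, even cycles). [folklore] -/
theorem sum_abs_arc_sub_arc (hM : M = n + n) (s t : ZMod M) :
    ∑ u : ZMod M, |(if (u - s).val < n then (1 : ℝ) else 0) - (if (u - t).val < n then 1 else 0)| =
      2 * ((min (s - t).val (M - (s - t).val) : ℕ) : ℝ) := by
  classical
  -- translate `u = v + t`
  rw [← Equiv.sum_comp (Equiv.addRight t)]
  simp only [Equiv.coe_addRight, add_sub_cancel_right]
  set w : ZMod M := t - s with hw
  have hvs : ∀ v : ZMod M, v + t - s = v + w := fun v => by rw [hw]; ring
  simp only [hvs]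
  -- `|a - b| = a + b - 2ab` for indicators
  have hind : ∀ v : ZMod M,
      |(if (v + w).val < n then (1 : ℝ) else 0) - (if v.val < n then 1 else 0)| =
        (if (v + w).val < n then (1 : ℝ) else 0) + (if v.val < n then 1 else 0) -
          2 * (if v.val < n ∧ (v + w).val < n then 1 else 0) := fun v => by
    by_cases h1 : (v + w).val < n <;> by_cases h2 : v.val < n <;> norm_num [h1, h2]
  simp only [hind]
  rw [Finset.sum_sub_distrib, Finset.sum_add_distrib, ← Finset.mul_sum,
    sum_arcShift_indicator hM w]
  have hhalf : ∑ v : ZMod M, (if v.val < n then (1 : ℝ) else 0) = n := by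
    simpa using sum_arcShift_indicator hM 0
  rw [hhalf]
  -- the intersection count lives on the first half ring
  have hinter : ∑ v : ZMod M, (if v.val < n ∧ (v + w).val < n then (1 : ℝ) else 0) =
      ((n - min w.val (M - w.val) : ℕ) : ℝ) := by
    rw [TorusBlock.sum_zmod_eq_sum_half_add hM
      (fun v => if v.val < n ∧ (v + w).val < n then (1 : ℝ) else 0)]
    have h1 : ∀ r : Fin n, (((r : ℕ) : ℕ) : ZMod M).val < n := fun r => by
      rw [ZMod.val_cast_of_lt (by have := r.isLt; omega)]; exact r.isLt
    have h2 : ∀ r : Fin n, ¬ ((((n + (r : ℕ) : ℕ)) : ZMod M).val < n) := fun r => by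
      rw [ZMod.val_cast_of_lt (by have := r.isLt; omega)]; omega
    simp only [h1, true_and, h2, false_and, if_false, Finset.sum_const_zero, add_zero]
    exact sum_fin_arcShift_indicator hM w
  rw [hinter]
  -- `d_M(t - s) = d_M(s - t)` and arithmetic
  have hsym : min w.val (M - w.val) = min (s - t).val (M - (s - t).val) := by
    rw [hw, ← TorusBlock.cyclicDist_neg (s - t), neg_sub]
  have hle : min w.val (M - w.val) ≤ n := by
    have := ZMod.val_lt w
    rw [Nat.min_def]; split_ifs <;> omega
  rw [← hsym, Nat.cast_sub hle]
  ring

/-! ### Negative type of the cyclic distance; infinite divisibility of the cyclic-exponential kernel -/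

/-- **`e^{-c·d_M}` is positive definite on the even cycle** (`M = 2n`, every `c ≥ 0`): by the
hypercube embedding, `e^{-c d_M(s-t)} = ∏_u e^{-(c/2)|a_u(s) - a_u(t)|}` is a finite Schur product of
pull-backs of the Ornstein–Uhlenbeck kernel. [folklore] -/
theorem isPosDefKernel_exp_neg_mul_cyclicDist (hM : M = n + n) {c : ℝ} (hc : 0 ≤ c) :
    IsPosDefKernel fun s t : ZMod M =>
      Real.exp (-(c * ((min (s - t).val (M - (s - t).val) : ℕ) : ℝ))) := by
  classical
  have hrepr : (fun s t : ZMod M =>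
      Real.exp (-(c * ((min (s - t).val (M - (s - t).val) : ℕ) : ℝ)))) =
      fun s t : ZMod M => ∏ u : ZMod M,
        Real.exp (-(c / 2 * |(if (u - s).val < n then (1 : ℝ) else 0) -
          (if (u - t).val < n then 1 else 0)|)) := by
    funext s t
    rw [← Real.exp_sum]
    congr 1
    rw [Finset.sum_neg_distrib, ← Finset.mul_sum, sum_abs_arc_sub_arc hM s t]
    ring
  rw [hrepr]
  refine isPosDefKernel_finsetProd (Finset.univ : Finset (ZMod M)) fun u _ => ?_
  exact (isPosDefKernel_exp_neg_mul_abs_sub (c := c / 2) (by linarith)).comp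
    (fun s : ZMod M => if (u - s).val < n then (1 : ℝ) else 0)

/-- **The cyclic distance on an even cycle is a negative definite kernel** (Schoenberg: `e^{-t d_M}`
is positive definite for all `t > 0`). Deza–Laurent (1997): even cycles are hypercube embeddable,
hence of negative type. [folklore] -/
theorem isNegDefKernel_cyclicDist (hM : M = n + n) :
    IsNegDefKernel fun s t : ZMod M => ((min (s - t).val (M - (s - t).val) : ℕ) : ℝ) :=
  isNegDefKernel_of_forall_isPosDefKernel_exp fun _ ht =>
    isPosDefKernel_exp_neg_mul_cyclicDist hM ht.le

/-- **`e^{-c Σᵢ d_M(xᵢ - yᵢ)}` is positive definite on `(ℤ/M)^d`** (`M` even, `c ≥ 0`): a Schur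
product over the coordinates of pull-backs of the one-dimensional kernel. [folklore] -/
theorem isPosDefKernel_exp_neg_mul_sum_cyclicDist {d : ℕ} (hM : M = n + n) {c : ℝ} (hc : 0 ≤ c) :
    IsPosDefKernel fun x y : TorusSite d M =>
      Real.exp (-(c * ∑ i : Fin d, ((min (x i - y i).val (M - (x i - y i).val) : ℕ) : ℝ))) := by
  classical
  have hrepr : (fun x y : TorusSite d M =>
      Real.exp (-(c * ∑ i : Fin d, ((min (x i - y i).val (M - (x i - y i).val) : ℕ) : ℝ)))) =
      fun x y : TorusSite d M => ∏ i : Fin d,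
        Real.exp (-(c * ((min (x i - y i).val (M - (x i - y i).val) : ℕ) : ℝ))) := by
    funext x y
    rw [← Real.exp_sum, Finset.mul_sum, Finset.sum_neg_distrib]
  rw [hrepr]
  refine isPosDefKernel_finsetProd (Finset.univ : Finset (Fin d)) fun i _ => ?_
  exact (isPosDefKernel_exp_neg_mul_cyclicDist hM hc).comp (fun x : TorusSite d M => x i)

/-- **The cyclic-exponential kernel is infinitely divisible as a SITE kernel**: for `M` even,
`0 < λ ≤ 1` and any dimension `d`, the kernel `K(x, y) = λ^{Σᵢ d_M(xᵢ - yᵢ)}` on `(ℤ/M)^d` has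
`-log K` of negative type (equivalently, Schoenberg/BCR Ch. 3 Prop. 2.7, every Hadamard power `K^t`,
`t > 0`, is positive definite). Contrast: its `b`-BLOCK kernels are not
(`TorusBlock.expKernel_not_isNegDefKernel_negLog_blockKernel`). [folklore] -/
theorem isNegDefKernel_negLog_cyclicExpKernel {d : ℕ} (hM : M = n + n) {lam : ℝ} (hlam : 0 < lam)
    (hlam1 : lam ≤ 1) :
    IsNegDefKernel fun x y : TorusSite d M =>
      -Real.log (lam ^ (∑ i : Fin d, min (x i - y i).val (M - (x i - y i).val))) := by
  have hc : 0 ≤ -Real.log lam := by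
    have := Real.log_nonpos hlam.le hlam1
    linarith
  have hrepr : (fun x y : TorusSite d M =>
      -Real.log (lam ^ (∑ i : Fin d, min (x i - y i).val (M - (x i - y i).val)))) =
      fun x y : TorusSite d M => (-Real.log lam) *
        ∑ i : Fin d, ((min (x i - y i).val (M - (x i - y i).val) : ℕ) : ℝ) := by
    funext x y
    rw [Real.log_pow, Nat.cast_sum]
    ring
  rw [hrepr]
  refine isNegDefKernel_of_forall_isPosDefKernel_exp fun t ht => ?_
  have hct : 0 ≤ t * (-Real.log lam) := mul_nonneg ht.le hc
  have h := isPosDefKernel_exp_neg_mul_sum_cyclicDist (d := d) hM hct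
  simpa only [mul_assoc] using h

end Literature.Probability.LatticeModels

end
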